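import Mathlib
import Summits.ValiantsHypothesis.ValiantsHypothesis.Theorems.NewtonUnitEquationsNewtonTauWeakAutomatonRadixDefs

/-!
# `NewtonUnitEquationsNewtonTauWeakAutomatonRadixRecursion` — mixed-radix carry automaton: bilinear self-similarity

Rung toward `NewtonTauWeak` (stmt-ValiantsHypothesis-5904), line `binomial-normal-form`, THEOREM C (mixed-radix carry
automaton, radix pair `(bx, by)`, level polynomials of degree `≤ C` per variable): registered stub `stub_radRecursion`,
the verbatim generalisation of `stub_genRecursion` (`…AutomatonGenRecursion.lean`, THEOREM B, radix `(2, 2)`) to an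
arbitrary radix pair `(bx, by)` with `2 ≤ bx`, `2 ≤ by`.

Claim.  Reading the levels `[0, h+m)` of the position `P = (bx^h H₁ + L₁, by^h H₂ + L₂)` (`L` in the low box
`[0, bx^h) × [0, by^h)`) is reading the levels `[0, h)` of `L` and then the levels `[0, m)` of `H` with the level
polynomials shifted by `h`: as matrices `N^{[0,h+m)}(P) = N^{[0,h)}(L) · N^{[h,h+m)}(P) = N_low(L) · N_high(H)`, and
`genContract k C` applied to the Kronecker product `high ⊗ low` is by definition the vector of entries of the blockwise
products `N_low · N_high` (the contraction does not depend on the radix).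

Proof.  `List.range' 0 (h+m) = List.range' 0 h ++ List.range' h m` splits the ordered product (`radN_split`); the
low factor only reads the base-`b` digits below `h`, which are those of `L`: for `i < h` and `L < b^h`,
`digit b i (b^h D + L) = digit b i L` (`digit_low`: write `b^h D + L = b^i (b^(h-i) D) + L`, divide by `b^i`, and
`% b` kills the multiple of `b`); the high factor reads the digits `h+i`, `i < m`, which are the digits `i` of `H`:
`digit b (h+i) (b^h D + L) = digit b i D` (`digit_high`: `(b^h D + L) / b^(h+i) = ((b^h D + L) / b^h) / b^i = D / b^i`
as `L / b^h = 0`), reindexing `List.range' h m = (List.range m).map (h + ·)` (`radN_high`).  Then unfold `genContract`,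
`radVecFin`, `radVec` at an index `gidxEquiv k C (l, κ, κ'')` and recognise `Matrix.mul_apply`, exactly as in
Theorem B. [folklore: carry automaton / transfer matrices of mixed-radix digit expansions]
-/

set_option linter.dupNamespace false

noncomputable section

open scoped BigOperators

namespace Summit.ValiantsHypothesis.ValiantsHypothesis.Theorems.NewtonTauWeakAutomaton

namespace RadRecursionAux

/-- Low digits of `b^h D + L` (`L < b^h`): for `i < h` the `i`-th base-`b` digit is that of `L`. [folklore] -/
theorem digit_low (b i h D L : ℕ) (hb : 0 < b) (hi : i < h) (hL : L < b ^ h) :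
    digit b i (b ^ h * D + L) = digit b i L := by
  unfold digit
  obtain ⟨d, rfl⟩ : ∃ d, h = i + (d + 1) := ⟨h - i - 1, by omega⟩
  rw [pow_add, mul_assoc, Nat.mul_add_div (Nat.pow_pos hb), pow_succ', mul_assoc, Nat.mul_add_mod]

/-- High digits of `b^h D + L` (`L < b^h`): the `(h+i)`-th base-`b` digit is the `i`-th digit of `D`. [folklore] -/
theorem digit_high (b i h D L : ℕ) (hb : 0 < b) (hL : L < b ^ h) :
    digit b (h + i) (b ^ h * D + L) = digit b i D := by
  unfold digit
  rw [pow_add, ← Nat.div_div_eq_div_mul, Nat.mul_add_div (Nat.pow_pos hb), Nat.div_eq_of_lt hL, Nat.add_zero]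

/-- Splitting the levels: the ordered product over `[0, h+m)` is the product over `[0, h)` times the product
over `[h, h+m)`. [folklore] -/
theorem radN_split (bx by' C : ℕ) (G : ℕ → MvPolynomial (Fin 2) ℂ) (h m : ℕ) (P : ℕ × ℕ) :
    radN bx by' C G 0 (h + m) P = radN bx by' C G 0 h P * radN bx by' C G h m P := by
  unfold radN
  rw [← List.range'_append_1, Nat.zero_add, List.map_append, List.prod_append]

/-- The low factor of `P = (bx^h H₁ + L₁, by^h H₂ + L₂)` (`L` in the low box) only reads the digits of `L`.
[folklore] -/
theorem radN_low (bx by' C : ℕ) (G : ℕ → MvPolynomial (Fin 2) ℂ) (h : ℕ) (H L : ℕ × ℕ) (hbx : 0 < bx)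
    (hby : 0 < by') (hL : L.1 < bx ^ h ∧ L.2 < by' ^ h) :
    radN bx by' C G 0 h (bx ^ h * H.1 + L.1, by' ^ h * H.2 + L.2) = radN bx by' C G 0 h L := by
  unfold radN
  congr 1
  apply List.map_congr_left
  intro i hi
  rw [List.mem_range'_1] at hi
  have hi' : i < h := by omega
  dsimp only
  rw [digit_low bx i h H.1 L.1 hbx hi' hL.1, digit_low by' i h H.2 L.2 hby hi' hL.2]

/-- The high factor of `P = (bx^h H₁ + L₁, by^h H₂ + L₂)` (`L` in the low box) reads the digits of `H`, with the
level polynomials shifted by `h`. [folklore] -/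
theorem radN_high (bx by' C : ℕ) (G : ℕ → MvPolynomial (Fin 2) ℂ) (h m : ℕ) (H L : ℕ × ℕ) (hbx : 0 < bx)
    (hby : 0 < by') (hL : L.1 < bx ^ h ∧ L.2 < by' ^ h) :
    radN bx by' C G h m (bx ^ h * H.1 + L.1, by' ^ h * H.2 + L.2) = radN bx by' C (fun i => G (i + h)) 0 m H := by
  unfold radN
  rw [List.range'_eq_map_range, List.range'_eq_map_range, List.map_map, List.map_map]
  congr 1
  apply List.map_congr_left
  intro i _
  simp only [Function.comp_apply, Nat.zero_add]
  rw [digit_high bx i h H.1 L.1 hbx hL.1, digit_high by' i h H.2 L.2 hby hL.2, Nat.add_comm h i]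

end RadRecursionAux

open RadRecursionAux in
/-- **Bilinear self-similarity of the mixed-radix carry-automaton configuration (Theorem C).**  In radix `(bx, by)`
(`2 ≤ bx`, `2 ≤ by`), the configuration vector over the levels `[0, h+m)` at the position
`(bx^h H₁ + L₁, by^h H₂ + L₂)` (`L` in the low box `[0, bx^h) × [0, by^h)`) is the contraction `genContract k C` of the
Kronecker product of the level-`[0, m)` configuration at `H` with the level polynomials shifted by `h` (high digits)
and the level-`[0, h)` configuration at `L` (low digits): blockwise, `N^{[0,h+m)}(b^h H + L) = N_low(L) · N_high(H)`.
[folklore: carry automaton / transfer matrices of mixed-radix digit expansions] -/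
theorem stub_radRecursion (bx by' k C h m : ℕ) (hbx : 2 ≤ bx) (hby : 2 ≤ by')
    (G : Fin k → ℕ → MvPolynomial (Fin 2) ℂ) (H L : ℕ × ℕ) (hL : L.1 < bx ^ h ∧ L.2 < by' ^ h) :
    radVecFin bx by' k C G 0 (h + m) (bx ^ h * H.1 + L.1, by' ^ h * H.2 + L.2) =
      genContract k C (fun ij => radVecFin bx by' k C (shiftLev G h) 0 m H (finProdFinEquiv.symm ij).1 *
        radVecFin bx by' k C G 0 h L (finProdFinEquiv.symm ij).2) := by
  have hbx0 : 0 < bx := zero_lt_two.trans_le hbx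
  have hby0 : 0 < by' := zero_lt_two.trans_le hby
  funext j
  obtain ⟨i, rfl⟩ : ∃ i, j = gidxEquiv k C i := ⟨(gidxEquiv k C).symm j, by simp⟩
  obtain ⟨l, κ, κ''⟩ := i
  simp only [genContract, LinearMap.coe_mk, AddHom.coe_mk, radVecFin, radVec, Equiv.symm_apply_apply]
  rw [radN_split, radN_low bx by' C (G l) h H L hbx0 hby0 hL, radN_high bx by' C (G l) h m H L hbx0 hby0 hL,
    Matrix.mul_apply]
  exact Finset.sum_congr rfl fun κ' _ => mul_comm _ _

end Summit.ValiantsHypothesis.ValiantsHypothesis.Theorems.NewtonTauWeakAutomaton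

end
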